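import Mathlib
import HarnessLib
import HarnessLib.Audit
import Summits.KontsevichZagierPeriods.Statement
import Literature.NumberTheory.Transcendental.KZProductIdeal
import Literature.NumberTheory.Transcendental.Associators
import Literature.NumberTheory.Transcendental.MZVShuffleRegularisation
import Literature.NumberTheory.Transcendental.MZVSimplexRep
import Literature.NumberTheory.Transcendental.MZVWordShuffle
import Literature.NumberTheory.Transcendental.MultipleZetaStuffle
import Literature.NumberTheory.Transcendental.MZVDualIndex
import HarnessLib.Audit.Status.Attr

/-!
Route: FurushoPentagon

DORMANT since 2026-08-26T16:13:33Z (reconciler: no traction for 5.6 d (last activity item-evidence-added at 2026-08-21T00:59:59Z); parked, not closed — `ledger route dormant route-KontsevichZagierPeriods-FurushoPentagon --off` to reacti) — unstaffed, not closed; items shared with open routes are served there. `ledger route dormant <id> --off` reactivates.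

# Route FurushoPentagon — one Stokes cell (the pentagon of M₀,₅(ℝ)) plus Furusho's transfer over the
rules ring generates every double-shuffle relation inside the KZ calculus

Realises card furusho-pentagon-mzv-sector (spine; it absorbed pentagon-suffices-furusho,
pentagon-furusho-squeeze,
pentagon-suffices-furusho-transfer, p-valued-associator-furusho-transfer). Work in the commutative
ring
P := KZ.FormalRep ⧸ KZ.relations (product = Fubini, `KZ.mul_sub_mul_comm_mem_relations`) and P_ℚ :=
ℚ ⊗ P. Let Φ_P ∈ P_ℚ⟨⟨X₀,X₁⟩⟩
be the RULES ASSOCIATOR: the coefficient of a convergent binary word is the class of the simplex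
representation `KZ.mzvRep`
(signs as in LeMurakami1996 / Furusho2003 Prop 3.2.3), divergent coefficients fixed algebraically by
shuffle regularisation
(X₀, X₁ ↦ 0). It suffices — for the multiple-zeta sector of Conjecture 1, MODULO TWO NAMED
CONJECTURES (the period conjecture
for MT(ℤ) in Brown's Hoffman-basis form = crux MzvPeriodConjecture, a hypothesis of `closes` since
rev 18; and "associator relations generate every
motivic MZV relation", the coordinate-ring form of GRT₁ ≅ U^{dR}_{MT(ℤ)}, implied by the algebraic
half of IharaKanekoZagier2006 Conjecture 1 — typed as
AssociatorHoffmanSpanning in the planner's Sketch.lean and carried, for want of an item slot, inside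
the declared remainder KernelModuloPeriodConjecture)
and Conjecture 1 off the sector — to show
X = X1 ∧ X3 (X2 is PROVED): X1 = PentagonInKZ (Φ_P satisfies Drinfeld's pentagon in U𝔞₄^∧ ⊗̂ P_ℚ;
geometrically: KZ-holonomy around
the boundary of the real cell X₅ ⊂ M₀,₅(ℝ) is trivial, i.e. 2-dimensional Stokes on one
semialgebraic 2-cell, coefficientwise
finitely many moves); X2 = ShuffleIsDissection (Φ_P is group-like: products of simplices dissect
into shuffled simplices — PROVED);
X3 = ReducedPeriodRing (P has no nilpotents; P_ℚ, a localisation of P, is then reduced). THEN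
Furusho2011 Thm 1.2
(group-like + pentagon ⇒ generalised double shuffle Δ_*(φ_*) = φ_* ⊗̂ φ_*, stated over a FIELD of
characteristic 0), applied at
every residue field of P_ℚ, puts all double-shuffle polynomials into the nilradical, hence to 0 by
X3 (support FurushoOverReduced, PROVED):
every regularised double-shuffle relation of Racinet2002 / IharaKanekoZagier2006 Thm 2 among MZV
simplex classes is a move
chain — the deliverable DoubleShuffleInKZ, reached by the PROVED implication DoubleShuffleOfPentagon
: X1 → X3 → DoubleShuffleInKZ (p84744);
in particular the typed core StuffleInKZ ∧ HoffmanRelationInKZ (IKZ's family (3); both also PROVED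
directly), Grothendieck item 0275
(ζ(4) = 4ζ(3,1)), and every associator identity of BarNatan1998. And Φ_P is then a group-like
solution of the pentagon over the REDUCED ℚ-algebra P_ℚ, i.e. a P_ℚ-point of Drinfeld's associator
scheme
𝔐' = GroupLike ∩ Pent (⊆ DMR by Furusho), which is how the named conjectures convert "relations
span" into "kernel ⊆ relations" on the sector: Hoffman
classes span the MZV sector of P_ℚ weight by weight by ONE universal ℚ-linear reduction formula
(GRT₁ ≅ U^{dR} in coordinate form), their real values are
ℚ-independent (MzvPeriodConjecture), a vanishing ℤ-combination is torsion modulo relations, hence a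
relation (the sector transfer, provable now).
Lean: `PentagonInKZ ∧ ReducedPeriodRing` (decls of this route; the two OPEN mechanism cruxes.
PentagonInKZ is typed in REALISATION form — for every
commutative ℚ-algebra R and every realisation χ : KZ.FormalRep →+ R of the rules (additive, killing
KZ.relations, multiplicative for the Fubini
product, non-degenerate) the χ-valued shuffle-regularised MZV series satisfies Drinfeld's pentagon —
kernel-checked EQUIVALENT (planner's
Equiv2.lean, `pentagonRealisation_iff`) to `NCSeries.DrinfeldPentagon KZ.rulesAssociator` over P_ℚ.
The route file imports only KZProductIdeal,
Associators, MZVShuffleRegularisation and the MZV simplex/stuffle/duality files; `multipleZeta` /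
`MZV.IsHoffman` come with them, no conjecture
leaf (`ZagierConjecture`, `KZKernelConjecture`) is named by any decl, decl cone 0 unproved.)

## Assembly
MECHANISM (PROVED as one implication, DoubleShuffleOfPentagon, `doubleShuffleOfPentagon_proof`,
p84744): PentagonInKZ → ReducedPeriodRing →
DoubleShuffleInKZ (ShuffleIsDissection, FurushoOverReduced, IntegerDivision enter as theorems) — the
route's DELIVERABLE, every regularised double-shuffle
relation inside the KZ calculus; a theorem the moment the two mechanism cruxes close, and not a
hypothesis of anything. DECIDING THEOREM (rev 18,
judge-repair 2026-08-16 — "closes re-headed with a named MT(ℤ) period-conjecture hypothesis as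
complement"):
`closes (hP : PentagonInKZ) (hR : ReducedPeriodRing) (hZ : MzvPeriodConjecture) (hC :
KernelModuloPeriodConjecture) (hS : StuffleInKZ)
(hH : HoffmanRelationInKZ) : KontsevichZagierPeriods := … hC hZ hP hR hS hH …`. Its OPEN hypotheses
are exactly: the two mechanism cruxes (r2 PentagonInKZ,
r3 ReducedPeriodRing), the NAMED transcendence input MzvPeriodConjecture (r8: the period conjecture
for MT(ℤ) on MZVs = ℚ-linear independence of the real
Hoffman values ⟺ `ZagierConjecture` given Brown2012 Thm 1.1; all the transcendence the sector needs,
never to be staffed by provers), and the declared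
remainder KernelModuloPeriodConjecture := MzvPeriodConjecture → PentagonInKZ → ReducedPeriodRing →
SectorToKernel (r9, NOT CLAIMED as a whole; it REPLACES
the rev-15 bespoke complement SectorToKernelOfPentagon = "mechanism ⇒ summit", the judge's smuggling
flag, and is weaker by the named antecedent). WHAT THE
REMAINDER CONTAINS, exactly: ON the MZV sector it is the algebraic leaf AssociatorHoffmanSpanning —
for every admissible s ONE universal ℚ-linear formula
reducing c_{w(s)}(φ) to Hoffman coefficients of the same weight at every group-like pentagon
solution φ over every REDUCED ℚ-algebra, i.e. Hoffman words span
𝒪(𝔐')_red weight by weight, EQUIVALENT (Brown2012) to GRT₁ ≅ U^{dR}_{MT(ℤ)} (Drinfeld1991;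
Furusho2011 §1; Andre2004 §25), decidable weight by weight and
verified wherever 𝔡𝔪𝔯₀ has been computed (IKZ p. 315: k ≤ 13; family (3) k ≤ 16) — through the
provable-now SECTOR TRANSFER PentagonInKZ → ReducedPeriodRing →
AssociatorHoffmanSpanning → MzvPeriodConjecture → (Conjecture 1 on the MZV sector) [Φ₀ =
`KZ.rulesAssociator` group-like pentagon point over reduced P_ℚ;
universal reduction formulas; `evalPQ` + `KZ.mzvRep_value_holds`; independence; torsion in ℚ ⊗ P by
`IsLocalization.tensorRight`; IntegerDivision — the
crux-ideate card grt-torsor-genericity on stmt-14829 reached the same cut independently and reports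
the transfer proved in its sketch]; OFF the sector it is
Conjecture 1 itself (elliptic / Γ / log periods, general Nori motives). Both pieces are typed and
lean-checked (planner's Sketch.lean, children.json) as the
glued split KernelModuloPeriodConjecture ⇐ [AssociatorHoffmanSpanning (crux), OffMzvSectorComplement
(crux, NOT CLAIMED: sector kernel ⇒ kernel form)] with
glue = the sector transfer — NOT filed now only because the route sits at both caps (15 items, 7
cruxes: 13 items are referenced by Theorems/ and Cruxes/
files and cannot leave) and `--split` is reserved to a seat's final cycle; the tenure planner files
it there. SectorToKernel (10813, auto-crux, crux chain
effective-cube-surjection running) stays in the cone as the remainder's DERIVED conclusion. Dropped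
at rev 18: Zeta4Calibration (= Grothendieck 0275).

Rationale: WHY THIS LINE. The pentagon is native to the INTEGRAL side — it is literally Stokes on the
associahedron cell of M₀,₅ for the flat KZ
connection (Drinfeld1991; Furusho2011 §2; cellular coordinates as in BrownModuli2009) — whereas the
stuffle is native to the
SERIES side, and the H21 calculus has integrals, never series; Furusho's two Annals theorems
(Furusho2010: pentagon ⇒
hexagons; Furusho2011 Thm 1.2: pentagon ⇒ double shuffle) are exactly the bridge that lets the
calculus never touch a
series or a divergent stuffle, and they are theorems of pure algebra, so they run inside the period
ring itself once its
two cheapest structural properties (no torsion — PROVED, IntegerDivision; no nilpotents — the rank-3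
crux, implied by the summit)
are granted. Imported areas: Grothendieck–Teichmüller / associator theory (Drinfeld1991,
BarNatan1998, Furusho2010,
Furusho2011, Racinet2002), the algebra of MZV regularisation (IharaKanekoZagier2006, Hoffman1992,
Hoffman1997), Brown's motivic
MZVs (Brown2012: Hoffman basis, dimension d_k) for the named complements, and commutative algebra of
the formal period ring
(Ayoub2014 Cor 32: ring structure of P is the non-transcendental half of the conjecture).
What it does that prior routes do not: route Grothendieck (items 0275/0277) ASSUMES "regularised
double shuffle ⊆ KZ.relations" relation
by relation, each needing its own convergent geometry; this line manufactures the whole infinite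
regularised family from ONE geometric
identity family on ONE 2-cell plus one structural property, every mechanism item is summit-necessary
(a refutation anywhere is
¬Conjecture 1), and — since rev 18 — what separates the mechanism from the summit is NAMED: the
MT(ℤ) period conjecture (Hoffman form, a hypothesis of
`closes`) and, inside the declared remainder, the associator-completeness conjecture GRT₁ ≅
U^{dR}_{MT(ℤ)} on the sector plus Conjecture 1 off it. Negatives index: 1 refuted
statement on the summit (KinematicFormulas.KinematicPlaneConvex), unrelated.

RANKED CRUXES. #2 PentagonInKZ (stmt-11348, REALISATION form: for every commutative ℚ-algebra R,
realisation χ of the rules and pinned Z, the χ-valued shuffle-regularised MZV series satisfies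
`NCSeries.DrinfeldPentagon`; kernel-checked equivalent to `NCSeries.DrinfeldPentagon
KZ.rulesAssociator`, Equiv2.lean `pentagonRealisation_iff`): "the rules associator Φ_P satisfies
Drinfeld's pentagon in U𝔞₄^∧ ⊗̂ P_ℚ; equivalently, for every weight n, the finitely many pentagon
coefficient identities, rewritten through shuffle regularisation as ℤ-polynomial identities among
classes of CONVERGENT simplex representations and their Fubini products, lie in KZ.relations" — why
it might fail: only through the constant-term (tangential base point) regularisation at the five
vertices of X₅, where words diverge; sources Drinfeld1991, Furusho2011 §2, BrownModuli2009,
BarNatan1998, LeMurakami1996, Furusho2003. Two crux-plan lines registered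
(logfree-gauge-corner-flatness, edge-normal-newton-leibniz). The lever is the support
FurushoOverReduced (stmt-11351): Furusho2011 Thm 1.2 over REDUCED commutative ℚ-algebras — PROVED
(`furushoOverReduced_proof`: field case = tree theorem `furusho_pentagon_doubleShuffle_holds`,
descended along R ↪ ∏_𝔭 Frac(R/𝔭) by `GeneralisedDoubleShuffle.of_map`). needs-fact: NONE.
#3 ReducedPeriodRing (crux) — the formal period ring P = KZ.FormalRep ⧸ KZ.relations has no
nilpotents: c·c ∈ KZ.relations ⇒ c ∈ KZ.relations (product = Fubini product of representations,
KZProduct.lean). The exact algebraic price of running Furusho's field-level theorem over P_ℚ;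
summit-implied (kernelImpliesReduced_proof: kernel form ⇒ reduced). [difficulty: L] (why it might
fail: a nilpotent = reps r, r′ with (r−r′)² a move chain to 0 but r ≁ r′; nothing in print either
way: even for Nori's EFFECTIVE formal period algebra reducedness is not in print (it would follow
from injectivity P̃⁺ → P̃⁺[1/2πi], open: HuberWustholz2022 App. A).) [Ayoub2014, HuberWustholz2022,
KontsevichZagier2001, Furusho2011] Line running: effective-end-monoid.
#4 HoffmanRelationInKZ (crux; CLOSED — PROVED, `hoffmanRelationInKZ_proof`, directly: cubical
transport, shuffle cells, stuffle dissection) — Hoffman's relation (Hoffman1992 Thm 5.1 = IKZ Thm 2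
(v), m = 1) for every admissible index as a ℤ-combination of `KZ.mzvRep` classes in KZ.relations.
[Hoffman1992, IharaKanekoZagier2006, Furusho2011]
#5 StuffleInKZ (crux; CLOSED — PROVED, `StuffleInKZ_of`) — the stuffle product [mzvRep s]·[mzvRep t]
− Σ_{u ∈ s∗t} [mzvRep u] ∈ KZ.relations for admissible s, t (Hoffman1997 §2). [Hoffman1997,
IharaKanekoZagier2006, Zagier1994, Furusho2011]
#— AssociatorHoffmanSpanning (TYPED LEAF, not an item at rev 18 — both caps are full; it is the
MZV-sector content of the remainder KernelModuloPeriodConjecture and the first child of its prepared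
glued split; conjecture-grade, NAMED) — for every admissible index s there is ONE finitely supported
b : {indices} → ℚ, supported on Hoffman indices t ∈ {2,3}^× of the same weight, such that
c_{w(s)}(φ) = Σ_t b_t · c_{w(t)}(φ) for every group-like solution φ of Drinfeld's pentagon over
every REDUCED commutative ℚ-algebra R (`NCSeries.IsGroupLike`, `NCSeries.DrinfeldPentagon`,
`[IsReduced R]`; regularisation c_{X₀} = c_{X₁} = 0 is automatic,
`DrinfeldPentagon.apply_letter_eq_zero_of_isGroupLike`, and so is the generalised double shuffle, by
the PROVED FurushoOverReduced). Read at the universal reduced point: the Hoffman words span each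
graded piece of 𝒪(𝔐')_red, 𝔐' = GroupLike ∩ Pent Drinfeld's associator scheme (Furusho2010: 𝔐' ∩ {c₂
= μ²/24} = M_μ, 𝔐' ∩ {c₂ = 0} = GRT₁), i.e. dim ≤ d_k; with 𝒪(𝔐')_red ↠ 𝓗 (the motivic associator)
and Brown2012 Thm 1.1 (Hoffman BASIS of motivic MZVs, dim 𝓗_k = d_k) it is EQUIVALENT to "every
motivic MZV relation is an associator relation", the coordinate-ring form of GRT₁ ≅ U^{dR}_{MT(ℤ)}
(Drinfeld1991; Furusho2011 §1, arXiv:0808.0319 p. 3: "It is conjectured that both groups [GRT₁,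
DMR₀] are isomorphic to the unipotent part of the motivic Galois group of ℤ"; Andre2004 §25;
Brown2012 proved U^{dR} ↪ GRT₁), and it is IMPLIED by DMR₀ ≅ U^{dR}, the algebraic half of
IharaKanekoZagier2006 Conjecture 1 (p. 315: φ_R : R_EDS → 𝒵 an isomorphism; spanning modulo the
double-shuffle ideal, which the associator ideal contains by Furusho2011 Thm 1.2) — so it is the
WEAKEST algebraic leaf in the chain 𝔤^𝔪 ⊆ 𝔤𝔯𝔱₁ ⊆ 𝔡𝔪𝔯₀. Independently reached, with the same two
leaves (AssociatorHoffmanReduction ∧ HoffmanValuesIndependent) and a torsor-minimality argument that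
the cut is exact, by the crux-ideate card grt-torsor-genericity on stmt-14829 (2026-08-16). (why it
might fail: fails iff in some weight k the associator ideal leaves more than d_k independent
admissible coefficients modulo nilpotents, i.e. dim(𝔤𝔯𝔱₁)_k > dim(𝔤^𝔪)_k — open; false for every k
where 𝔡𝔪𝔯₀ has been computed: k ≤ 13 (IKZ p. 315), k ≤ 16 via family (3) (Minh–Petitot),
machine-checked beyond (doi:10.1007/978-0-387-78133-4_4).) [each weight a finite ℚ-linear-algebra
certificate, provable now for small k] [Drinfeld1991, Furusho2011, Furusho2010,
IharaKanekoZagier2006, Racinet2002, Brown2012, Andre2004]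
#8 MzvPeriodConjecture (crux, conjecture-grade, NAMED; rev 18) — THE PERIOD CONJECTURE FOR MT(ℤ) ON
MULTIPLE ZETA VALUES, Hoffman form: the real numbers ζ(s), s ∈ {2,3}^× (all weights, ζ(∅) = 1
included) are ℚ-linearly independent — `LinearIndependent ℚ (fun s : {s // MZV.IsHoffman s} =>
multipleZeta s.1)`. By Brown2012 Thm 1.1 (motivic Hoffman elements are a basis of 𝓗) it is
EQUIVALENT to injectivity of the period map 𝓗 → ℝ (Grothendieck's period conjecture for MT(ℤ) on its
real MZV periods; Andre2004 §§23–25, HuberMullerStach2017 Ch. 13) and, with hoffmanSpan_eq_mzvSpace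
+ card_hoffman_eq_zagierDim, to the tree's `ZagierConjecture` (dimension d_k ∧ weight grading:
Zagier1994 §9, Goncharov ECM 2000 Conj 1.1); it is the transcendence half of Hoffman1997's basis
conjecture (Brown2012 p. 3). Stated unfolded, so no conjecture leaf enters the cone; the same
hypothesis is `HoffmanIndependent` in the TwoPosets skeleton of LinRedNormalForm.MzvKernelInKZ and
`HoffmanValuesIndependent` in card grt-torsor-genericity. Since rev 18 a HYPOTHESIS OF `closes` (the
judge's ask) and the antecedent of the remainder; it occupies the slot freed by dropping
Zeta4Calibration. (why it might fail: it is open transcendence: false iff one ℚ-linear relation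
among real Hoffman MZVs exists — weight 5 already asks ζ(5) ∉ ℚζ(2)ζ(3); known only: weights ≤ 4
(trdeg ℚ(π) = 1) and ζ(3) ∉ ℚ (Apéry).) NOT to be staffed by provers. [difficulty: open-problem]
[Brown2012, Hoffman1997, Zagier1994, Andre2004, KontsevichZagier2001]
#9 KernelModuloPeriodConjecture (crux, rev 18 = the 1:1 RESTATEMENT of SectorToKernelOfPentagon
stmt-14829; DECLARED REMAINDER — NOT CLAIMED as a whole) — MzvPeriodConjecture → PentagonInKZ →
ReducedPeriodRing → SectorToKernel: given the named transcendence input and the mechanism,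
Conjecture 1's kernel form (SectorToKernel's own antecedents StuffleInKZ, HoffmanRelationInKZ being
theorems). Weaker than the rev-15 complement by the named antecedent; implied by SectorToKernel and
by the old SectorToKernelOfPentagon. CONTENT, exactly: ON the MZV sector = AssociatorHoffmanSpanning
(GRT₁ ≅ U^{dR}, typed above) through the provable-now sector transfer; OFF the sector = Conjecture 1
(elliptic / Γ / log periods, general Nori motives — pieces owned by Grothendieck.SectorComplement,
LinRedNormalForm.ResidualBeyondGenusZero, HyperbolicBloch, NoriTransfer). PREPARED GLUED SPLIT
(children.json + glue text attached as route evidence, every statement lean-checked):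
KernelModuloPeriodConjecture ⇐ AssociatorHoffmanSpanning (crux) → OffMzvSectorComplement (crux, NOT
CLAIMED: MZV-sector kernel ⇒ kernel form) with glue MzvSectorTransfer (support, provable now: the
transfer) — to be filed by the tenure planner on the route's final cycle (`--split` is refused
before). (why it might fail: summit strength off the sector, and on it exactly GRT₁ ≅ U^{dR}: false
iff a vanishing ℤ-combination with a non-MZV member has no move chain, or some weight has
dim(𝔤𝔯𝔱₁)_k > dim(𝔤^𝔪)_k, even with the period conjecture, pentagon and reducedness true.)
[difficulty: open-problem] [KontsevichZagier2001, Drinfeld1991, Furusho2011, Brown2012, Ayoub2015,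
HuberMullerStach2017]
#9 SectorToKernel (stmt-10813; auto-crux, conjecture-grade) — StuffleInKZ → HoffmanRelationInKZ →
kernel form (∀ c, KZ.eval c = 0 → c ∈ KZ.relations): the kernel form of Conjecture 1 itself given
its two proved antecedents; since rev 18 the CONCLUSION of KernelModuloPeriodConjecture (in the
cone, derived side); a crux chain runs on it (lead line effective-cube-surjection: bridge to
Ayoub2015 Conj 1.1 via cube compilation) and closes the remainder as a by-product. (why it might
fail: it is Conjecture 1's kernel form.) [KontsevichZagier2001, Ayoub2015, Ayoub2014,
IharaKanekoZagier2006, Brown2012, HuberMullerStach2017]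
#— MzvSectorKernel (TYPED TARGET, not an item at rev 18: caps) — Conjecture 1 in kernel form ON THE
MULTIPLE-ZETA SECTOR: every ℤ-combination of simplex classes `KZ.of (KZ.mzvRep s …)` (s admissible,
∅ ↦ [pt,1]) with eval 0 lies in KZ.relations; the antecedent of the prepared child
OffMzvSectorComplement and the conclusion of the sector transfer; summit-implied; =
LinRedNormalForm.MzvKernelInKZ up to rational factors (`wordRep_bword_eq_mzvRep` + integrand
additivity + IntegerDivision). [KontsevichZagier2001, IharaKanekoZagier2006, Brown2012]
Supports: FurushoOverReduced (PROVED); ShuffleIsDissection (PROVED, X2: products of simplices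
dissect into shuffled simplices, Eie2013 §1.2); IntegerDivision (PROVED in tree,
`integerDivision_proof` via MzvKernelInKZ.Negative.mem_relations_of_nsmul_mem; n•c ∈ relations ⇒ c ∈
relations for n > 0); DoubleShuffleInKZ (the DELIVERABLE: in every realisation the regularised
series satisfies `NCSeries.GeneralisedDoubleShuffle` — IKZ Thm 2's full EDS family, Racinet2002 Def
3.1; a theorem once PentagonInKZ ∧ ReducedPeriodRing close); DoubleShuffleOfPentagon (PROVED,
p84744: PentagonInKZ → ReducedPeriodRing → DoubleShuffleInKZ at the universal realisation χ₀ into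
P_ℚ, group-likeness by `isGroupLike_realisation`, P_ℚ reduced as a localisation, FurushoOverReduced,
transport by `exists_realisation_lift` + `GeneralisedDoubleShuffle.map`); MzvSectorTransfer (TYPED
GLUE of the prepared split, provable now, ~200 lines — not an item at rev 18):
AssociatorHoffmanSpanning → OffMzvSectorComplement → KernelModuloPeriodConjecture; its heart
PentagonInKZ → ReducedPeriodRing → AssociatorHoffmanSpanning → MzvPeriodConjecture → MZV-sector
kernel is spelled out in the thesis (## Assembly) and in the attached glue text (Φ₀ =
`KZ.rulesAssociator` reduced pentagon point, universal reduction formulas, `evalPQ` +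
`KZ.mzvRep_value_holds`, independence, torsion by `IsLocalization.tensorRight`, IntegerDivision);
card grt-torsor-genericity reports the signed variant `mzvSpanKernel_of` PROVED in its sketch. A
prover may land it today as a SUPPORT LEMMA under Theorems/ with `--supports`
KernelModuloPeriodConjecture. Dropped at rev 18: Zeta4Calibration (= Grothendieck 0275, stays
there). Restated: SectorToKernelOfPentagon (14829) → KernelModuloPeriodConjecture (its crux-ideate
round — cards grt-torsor-genericity, nilradical-residue-fields, real-spectrum-positive-cone — is
absorbed: the first card IS the rev-18 cut; Cruxes/SectorToKernelOfPentagon/SketchIdeator1.lean goes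
stale with the retired decl). Earlier: KernelImpliesStatement (rev 1), FurushoTransfer →
FurushoOverReduced (rev 2). 15 items, 7 crux badges (P, R open; H, S proved; MzvPeriodConjecture
named; KernelModuloPeriodConjecture, SectorToKernel remainder class).

TWO-LAYER PLAN. PREPARED (files attached, lean-checked; to be filed on the final cycle):
KernelModuloPeriodConjecture ⇐ AssociatorHoffmanSpanning → OffMzvSectorComplement with glue
MzvSectorTransfer (provable now). Foreseen: PentagonInKZ ⇐ TruncatedHolonomy (for rational ε > 0 the
holonomy of KZ around the ε-inset piecewise-algebraic pentagon γ_ε ⊂ X₅ is EXACTLY 1,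
coefficientwise a move chain uniform in ε: Chen's formula + Arnold relations = integrand additivity,
boundary terms = Newton–Leibniz; or the interior-basepoint telescoping form at one rational point,
all representations convergent) → CornerConstantTerm (the ε⁰-term at the five tangential base points
equals the shuffle-regularised classes) → PentagonInKZ — the two registered crux-plan lines cut it
this way. ReducedPeriodRing ⇐ either dropped via F1 = FurushoIdealLevel (Pent ∩ GroupLike ⊆ DMR
ideal-theoretically over ℚ) or traded via F3 = HexagonInKZ over P_ℚ[i] with μ = 2i[π] +
`KZ.PiCancellation` (route AyoubSpecialisation 0540). AssociatorHoffmanSpanning ⇐ per-weight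
certificates (small k provable now by finite linear algebra) → all weights (open).

KILL CRITERIA. Every MECHANISM item is summit-necessary: a refutation of StuffleInKZ,
HoffmanRelationInKZ, ShuffleIsDissection,
DoubleShuffleInKZ or PentagonInKZ exhibits two rational representations with equal value that are
not KZ-equivalent, i.e. ¬Conjecture 1 —
close `refuted:<Decl>`, hand the additive move-invariant to route Neg, escalate to the operator. A
refutation of ReducedPeriodRing
(a nilpotent class) refutes the summit too (kernelImpliesReduced_proof) — same action. The NAMED
complements are different in kind:
¬AssociatorHoffmanSpanning in some weight k = a motivic MZV relation outside the associator +
double-shuffle ideal (GRT₁ ≠ U^{dR}) — a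
major result in its own right; it does NOT touch the mechanism: pivot = restate the algebraic
complement to the weaker rules-level
"Hoffman classes span the MZV sector of P_ℚ" (then an honest rules-side residual) and keep the line;
¬MzvPeriodConjecture = a ℚ-linear
relation among real Hoffman MZVs, i.e. ¬(period conjecture for MT(ℤ)) — kills the kernel claim of
EVERY MZV-sector route at once
(this one, LinRedNormalForm.MzvKernelInKZ, Grothendieck's MZV count) while leaving the spanning
deliverable DoubleShuffleInKZ intact;
KernelModuloPeriodConjecture never kills the line (declared remainder; a refutation OFF the sector
is ¬Conjecture 1, ON the sector it is ¬(GRT₁ ≅ U^{dR}) — the pivot above). What forces a PIVOT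
rather than a close: PentagonInKZ released at
CornerConstantTerm ⇒ restate through the interior-basepoint form; a grounder finding F1 in print ⇒
drop ReducedPeriodRing from the
mechanism (route simplifies).

NOT DECOMPOSED YET. The unfolding of DoubleShuffleInKZ into individual `∈ KZ.relations` statements
per index pair (routine); the prepared split of KernelModuloPeriodConjecture (above); the two-line
bridge MZV-sector kernel ↔ LinRedNormalForm.MzvKernelInKZ (q-multiples by integrand additivity +
IntegerDivision); per-weight certificate
instances of AssociatorHoffmanSpanning; the alternative remainder shape OffSectorResidual (∀ c, eval
c = 0 → ∃ c′ in the MZV sector, c − c′ ∈ relations — the shape of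
LinRedNormalForm.ResidualBeyondGenusZero, shared with sibling cards on 10813) if a common remainder
item across sector routes is wanted; the hexagon/[π] branch F3; Furusho2011 Thm 1.5 (double shuffle
⇒ Γ-factorisation of the
meta-abelian quotient: Euler's beta expansion coefficientwise in P — a calibration family linking
the MZV fragment to the Γ-sector);
all layer-2 or support, later.

CHEAPEST FALSIFIER. (i) Lookup (a grounder, one afternoon): do Furusho2011 / Racinet2002 /
Enriquez–Furusho give Pent ∩ GroupLike ⊆ DMR at the
level of coordinate rings over ℚ (F1)? If yes, ReducedPeriodRing leaves the mechanism
(simplification, not a kill).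
(ii) Weight ≤ 4 dry run of PentagonInKZ (pentagon coefficient identities of weight 3–4 from
BarNatan1998's tables, ε-inset Stokes by hand for ONE of them): superseded by the two registered
crux-plan lines, whose stubs are exactly these rungs. (iii) StuffleInKZ at s = t = (2):
DONE (proved). (iv) NEW, cheap and informative either way: the weight-k certificate of
AssociatorHoffmanSpanning for k = 5…8 by exact
ℚ-linear algebra on the pentagon + double-shuffle + shuffle coefficient identities (one `kit
compute` job, or in-Lean `decide`-sized for
k ≤ 6 as in TwoPosets' stub_edsCertificateLow) — a failure in low weight would contradict IKZ's
published verification and signal a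
MIS-TYPING of the item (sign/regularisation convention), to be repaired by restating, not a dead
line.

NUMBERS. Zagier dimensions d_k (1,0,1,1,1,2,2,3,4,5,7,9,12,16,21 for k = 0…14; `zagierDim`), upper
bound dim 𝒵_k ≤ d_k (Terasoma2002,
Brown2012; tree facts `finrank_mzvSpace_le_zagierDim`, `hoffmanSpan_eq_mzvSpace`;
card_hoffman_eq_zagierDim proved). IKZ experimental
status (IharaKanekoZagier2006 p. 315): FDS + EDS reduce the formal dimension to d_k for k ≤ 13; FDS
+ Hoffman (family (3) = this route's
typed core) to k ≤ 16 (Minh–Petitot); FDS alone fails in weights 3, 4; family (4) fails at weight 13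
(17 vs 16); machine verification
beyond: Kaneko–Noro–Tsurumaki, doi:10.1007/978-0-387-78133-4_4. Furusho2011: Thm 1.2 over a field k,
char k = 0 (§2, p. 5 of
arXiv:0808.0319); DMR₀ needs c_{X₀} = c_{X₁} = c_{X₀X₁} = 0; hexagons force c_{X₀X₁} = μ²/24; Cor
1.3: GRT₁ ⊂ DMR₀. Brown2012
(arXiv:1102.1312) Thm 1.1: {ζ^𝔪(s) : s ∈ {2,3}^×} is a basis of 𝓗; U^{dR} free pro-unipotent on σ₃,
σ₅, …, so Σ dim 𝓗_k t^k =
1/(1−t²−t³). Items: 15 at rev 18, both caps full (13 items are referenced by Theorems/ and Cruxes/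
files); the new statements name no conjecture leaf and no unproved Literature fact (multipleZeta,
MZV.IsHoffman, NCSeries.* are definitions).

DEFINITION REQUESTS. None open — D1 Associators.lean, D2 MZVShuffleRegularisation.lean, D3
KZRulesAssociator.lean (used by Theorems files only) all landed 2026-08-15.

Novelty: Searches (2026-08-15): `lit search --source zbmath "Kontsevich Zagier period conjecture multiple
zeta values double shuffle"`
(1: Terasoma 2010 survey zbl:1242.14009); `--source zbmath "pentagon equation double shuffle
relation"` (1: Furusho2011);
`--source zbmath "associator pentagon equation period conjecture rules of calculus"` (0); `--source
zbmath "formal period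
algebra reduced nilpotent effective periods injectivity"` (0); `--source crossref "Kontsevich-Zagier
conjecture multiple zeta
values accessible identities"` (8: Viu-Sos thesis, Zagier Annals 2012, Ayoub2015,
AyoubRelKZRevisited, Ohno–Zagier 2001 —
none derives MZV identities inside the rules); `lit frontier KontsevichZagierPeriods --since 2020`
(30 rows; nearest
tangents: "A polynomial basis for the stuffle algebra" J. Algebra 2026
doi:10.1016/j.jalgebra.2026.01.026, DupontPanzerPym2026
log corners — no rules statement); `lit galaxy search … --star all` ×2 (galaxyd queue saturated > 90
s, retried once);
local searchd (connection reset, then rc 0 on zbMATH/crossref). READ this session: Furusho2011 =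
arXiv:0808.0319 pp. 3, 5
(Thm 1.1, Thm 1.2, Cor 1.3–1.4; §2: k a field of characteristic 0, pentagon in U𝔞₄, (double shuffle)
:= Δ_*(φ_*) = φ_* ⊗̂ φ_*,
Thm 2.1 5-cycle form); IharaKanekoZagier2006 = doi:10.1112/S0010437X0500182X pp. 314–315, 324 (Thm 2
(i)–(v′) over any
ℚ-algebra R; Conjecture 1 and its variants (1)–(4); Thm 3, Cor 6). Plus the card's two refuter
audits (Furusho pp. 2–6, 12;
Brown arXiv:1301.3053 pp. 5  [refs: 10.1016/j.jalgebra.2026.01.026, 10.1112/S0010437X0500182X, 0808.0319, 1301.3053, doi:10.1016/j.jalgebra.2026.01.026, doi:10.1112/S0010437X0500182X, Furusho2011, Ayoub2015, DupontPanzerPym2026, IharaKanekoZagier2006, Souderes2010, Racinet2002]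

Barriers (technique_class: associator-transfer, cell-stokes, period-ring-structure): - technique_class: associator-transfer, cell-stokes, period-ring-structure
- Literature.Barriers.KontsevichZagierPeriods.kzConjecture_implies_oddZetaAlgIndep: this IS the
sector's barrier and it is respected, not evaded: the route proves RELATIONS (spanning half: double
shuffle ⊆ KZ.relations), transcendence-free; independence of ζ(odd) enters only through the named
hypothesis inside SectorToKernel (period conjecture for MT(ℤ) / `ZagierConjecture`), exactly as
route Grothendieck does.
- Literature.Barriers.KontsevichZagierPeriods.kzConjecture_implies_twoPiI_log_algIndep: outside the
sector (no claim about log or 2πi independence); [π] appears only in the optional F3 branch, as a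
ring element, never as a transcendence statement.
- Literature.Barriers.KontsevichZagierPeriods.kzConjecture_implies_ellipticPeriods_algIndep: outside
the sector (mixed Tate over ℤ only).
- Literature.Barriers.KontsevichZagierPeriods.noSemialgebraicPrimitive_inv_sub_two: evaded by
construction — iterated integrals are never used as primitives: in TruncatedHolonomy they are
UNFOLDED into integrals of rational forms over [0,1] × Δⁿ (homotopy parameter × simplex) before
anything is differentiated, so every Newton–Leibniz instance has a RATIONAL primitive (a component
of the pulled-back integrand; Chen's formula + Arnold relations supply the pointwise rational
certificate), i.e. the barrier's own recorded evasion "add variables"; the transcendental holonomy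
function of the path parameter never appears as

Novelty grade: new-combination — ROUTE REVIEW (refuter, 2026-08-15). VERDICT: typed core sound, released; rank-2 crux untyped. 11/11 typed items elaborate (W3.lean rc0), all stamped with briefings; KernelImpliesReduced 3935, KernelImpliesStatement 0197 (already Theorems/KernelFormKernelImpliesStatement.lean), Assembly 3937 PROVED s (refuter refuter-rreview-route-KontsevichZagierPe-1621807a-0, 2026-08-15T13:39:30Z; prior: arXiv:0808.0319 (Furusho2011 Thm 1.2: pentagon ⇒ double shuffle over a field of char 0), Souderes2010 (geometric/motivic double shuffle: the motivic-level precedent of 'relations from geometry'), doi:10.1112/S0010437X0500182X (IharaKanekoZagier2006: regularised double shuffle family), Ayoub2014 Cor. 32 / Ayoub2015 (ring structure of formal KZ periods; relative version), BrownENS2009 / BrownModuli2)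

History (route lifecycle, newest last):
- 2026-08-15T16:49:54Z · rev 4: restated KernelImpliesReduced (stmt-KontsevichZagierPeriods-3935) — route-repair: restate KernelImpliesReduced with the kernel form written out (definitionally equal to the rev-0 statement, Iff.rfl) — removes the last decl namin (planner-rbadge-KontsevichZagierPeriods-Furusho-0de2f5a6-g2-0)
- 2026-08-15T17:17:12Z · rev 6: restated PentagonInKZ (stmt-KontsevichZagierPeriods-4110) — route-repair (import cone): restate PentagonInKZ in REALISATION form (∀ comm ℚ-algebra R, ∀ realisation χ of the rules: pentagon for the χ-valued regularised MZ (planner-rbadge-KontsevichZagierPeriods-Furusho-0de2f5a6-g2-0)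
- 2026-08-15T17:22:50Z · rev 7: restated FurushoTransfer (stmt-KontsevichZagierPeriods-5054) — route-repair (import cone): replace support FurushoTransfer (typed over KZ.rulesAssociator) by FurushoOverReduced = Furusho2011 Thm 1.2 over REDUCED ℚ-algebras (planner-rbadge-KontsevichZagierPeriods-Furusho-0de2f5a6-g2-0)
- 2026-08-16T02:17:47Z · AUTO-CRUX: 1 conjecture-grade item(s) promoted to crux (SectorToKernel) — refuter vetting / tiering apply (operator:999:1362873)
- 2026-08-16T05:40:43Z · rev 11: restated DoubleShuffleOfPentagon (stmt-KontsevichZagierPeriods-14666) — route-repair g3: restate DoubleShuffleOfPentagon (stmt-14666, rendered BLOCKED at rev 10: the gate orders support items by item-id STRING, so its by-name antece (planner-rbadge-KontsevichZagierPeriods-Furusho-0de2f5a6-g3-0)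
- 2026-08-16T07:37:05Z · rev 18: dropped Zeta4Calibration — judge-repair rev 18, step 1/3: drop the calibration record Zeta4Calibration from THIS route (it is route Grothendieck's crux item 0275 verbatim and stays there; (planner-rrepair-KontsevichZagierPeriods-Furush-294e16d9-0)
- 2026-08-16T07:38:51Z · rev 20: restated SectorToKernelOfPentagon (stmt-KontsevichZagierPeriods-14829) — judge-repair step 3/3: RESTATE the bespoke complement SectorToKernelOfPentagon (mechanism ⇒ summit; judge's smuggling flag) 1:1 into the declared remainder Kern (planner-rrepair-KontsevichZagierPeriods-Furush-294e16d9-0)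
- 2026-08-26T16:13:33Z · DORMANT — reconciler: no traction for 5.6 d (last activity item-evidence-added at 2026-08-21T00:59:59Z); parked, not closed — `ledger route dormant route-KontsevichZagier (operator:999:309609)

sub-problem: KontsevichZagierPeriods · status: dormant · opened planner-plancard-KontsevichZagierPeriods-Kont-1900b192-0 2026-08-15T11:26:10Z · rev 21 · ledger route-KontsevichZagierPeriods-FurushoPentagon
GENERATED by the gate from the ledger (D-0016/17). Provers cite these decls: `theorem foo : Summit.KontsevichZagierPeriods.KontsevichZagierPeriods.Theses.FurushoPentagon.<Decl> := …` in Summits/KontsevichZagierPeriods/KontsevichZagierPeriods/Theorems/<Name>.lean.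
-/

namespace Summit.KontsevichZagierPeriods.KontsevichZagierPeriods.Theses.FurushoPentagon

open scoped BigOperators Topology Manifold Classical MeasureTheory ProbabilityTheory Matrix InnerProductSpace ComplexConjugate ContinuousMap
open Filter Set Function TopologicalSpace MeasureTheory

attribute [summit_statement] _root_.KontsevichZagierPeriods

open Literature Periods

-- earlier PentagonInKZ (stmt-KontsevichZagierPeriods-4110, replaced 2026-08-15T17:17:12Z -> stmt-KontsevichZagierPeriods-11348): retired by None — Literature.NumberTheory.Transcendental.NCSeries.DrinfeldPentagon Literature.NumberTheory.Transcendental.KZ.rulesAssociator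
/-- item stmt-KontsevichZagierPeriods-11348 · crux · rank 2 · closed · proved by Summit.KontsevichZagierPeriods.FurushoPentagon.PentagonInKZ.PentagonInKZ_of @ 4417144fbe28 (prover) · by planner
why it might fail: Only non-move step is the corner constant term: the ε-inset holonomy identity on X₅ is a move chain for each rational ε, but KZ.relations has no limit/regularisation move, so the ε⁰-term at the 5 tangential base points needs every [log ε]-counterterm class derived by moves.
sources: Drinfeld1991, Furusho2011, arXiv:0808.0319, Furusho2003, BrownModuli2009, BarNatan1998
[crux] PentagonInKZ (rank 2, hardest and most informative; card item (c)) — REALISATION FORM (rev 2,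
route-repair 2026-08-15). For every commutative ℚ-algebra R and every REALISATION χ : KZ.FormalRep
→+ R of the Kontsevich–Zagier rules — additive, killing KZ.relations (the four moves),
multiplicative for the Fubini product, non-degenerate (some χ u = 1; equivalently χ[pt, 1] = 1 by
the unit law mod relations) — and every assignment Z of the simplex representations KZ.mzvRep to
admissible indices, the χ-valued shuffle-regularised multiple-zeta series Φ_{χ} := Σ_W (−1)^{#X₁(W)}
(Σ_v reg_ш(W)(v) · χ(Z(index of v))) · W ∈ R⟨⟨X₀,X₁⟩⟩ (reg_ш = `MZV.shuffleReg`,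
IharaKanekoZagier2006 §3 / Cor 5, supported on convergent words v, so only admissible indices are
read; signs of LeMurakami1996 Thm A.9 as corrected by Furusho2003 Prop 3.2.3, so that χ = evaluation
gives Drinfeld's real Φ_KZ) satisfies Drinfeld's pentagon equation Φ(t₁₂,t₂₃+t₂₄)Φ(t₁₃+t₂₃,t₃₄) =
Φ(t₂₃,t₃₄)Φ(t₁₂+t₁₃,t₂₄+t₃₄)Φ(t₁₂,t₂₃) in U𝔞₄^∧ ⊗̂ R (`NCSeries.DrinfeldPentagon`, Furusho2011 §2;
Drinfeld1991). EQUIVALENT — kernel-checked in both directions, planner's Equiv2.lean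
`FaithfulSketch.pentagonRealisation_iff`, attached as e -/
@[route_item "route-KontsevichZagierPeriods-FurushoPentagon", crux]
def PentagonInKZ : Prop :=
  ∀ (R : Type) [CommRing R] [Algebra ℚ R] (χ : Literature.NumberTheory.Transcendental.KZ.FormalRep →+ R), (∀ c ∈ Literature.NumberTheory.Transcendental.KZ.relations, χ c = 0) → (∀ a b : Literature.NumberTheory.Transcendental.KZ.FormalRep, χ (a * b) = χ a * χ b) → (∃ u : Literature.NumberTheory.Transcendental.KZ.FormalRep, χ u = 1) → ∀ Z : List ℕ → Literature.NumberTheory.Transcendental.KZ.FormalRep, (∀ (u : List ℕ) (hu : Literature.NumberTheory.Transcendental.MZV.IsAdmissible u), Z u = Literature.NumberTheory.Transcendental.KZ.of (Literature.NumberTheory.Transcendental.KZ.mzvRep u hu (Literature.NumberTheory.Transcendental.KZ.mzvIntegrand_isSemialgebraicFunOn_holds u) (Literature.NumberTheory.Transcendental.KZ.mzvIntegrand_integrableOn_holds u hu))) → Literature.NumberTheory.Transcendental.NCSeries.DrinfeldPentagon (R := R) (fun W : List Bool => (-1 : R) ^ (W.count true) * (Literature.NumberTheory.Transcendental.MZV.shuffleReg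 W).sum (fun v a => a • (if Literature.NumberTheory.Transcendental.MZV.IsConvergentWord v then χ (Z (Literature.NumberTheory.Transcendental.MZV.ofBinaryWord v)) else (0 : R))))

-- `PentagonInKZ` holds: proved by `Summit.KontsevichZagierPeriods.FurushoPentagon.PentagonInKZ.PentagonInKZ_of` @ 4417144fbe28 (its module imports this route file, so no `_holds` link can be stated here).

/-- item stmt-KontsevichZagierPeriods-3929 · crux · rank 3 · open · by planner
why it might fail: A nilpotent = reps r, r′ with (r−r′)² a move chain to 0 but r ≁ r′; nothing in print either way — even for Nori's effective formal period algebra reducedness is open (it would follow from injectivity P̃⁺ → P̃⁺[1/2πi], HuberWustholz2022 App. A); only the summit implies it.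
sources: Ayoub2014, HuberWustholz2022, KontsevichZagier2001, Furusho2011
[crux] the formal period ring P = KZ.FormalRep ⧸ KZ.relations has no nilpotents: c·c ∈ KZ.relations
⇒ c ∈ KZ.relations (product = Fubini product of representations, KZProduct.lean). Card item (d)
ReducedOrF1, branch F2; the exact algebraic price of running Furusho's field-level theorem over P_ℚ.
[difficulty: L] -/
@[route_item "route-KontsevichZagierPeriods-FurushoPentagon", crux]
def ReducedPeriodRing : Prop :=
  ∀ c : Literature.NumberTheory.Transcendental.KZ.FormalRep, c * c ∈ Literature.NumberTheory.Transcendental.KZ.relations → c ∈ Literature.NumberTheory.Transcendental.KZ.relations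

/-- item stmt-KontsevichZagierPeriods-3930 · crux · rank 4 · closed · proved by Summit.KontsevichZagierPeriods.FurushoPentagon.HoffmanRelationInKZ.hoffmanRelationInKZ_proof (prover) · by planner
why it might fail: First family where ζ(1) enters: classical proofs are series/partial fractions (Hoffman1992 Thm 5.1) or regularised integrals; a move proof must cross the corner t = 1 with absolutely convergent intermediates — route Neg's pressure point (a). (PROVED 2026-08-16.)
sources: Hoffman1992, IharaKanekoZagier2006, Furusho2011
[crux] for every admissible index s = (s₁,…,s_k), Hoffman's relation Σ_i ζ(s₁,…,s_i+1,…,s_k) = Σ_i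
Σ_{j=0}^{s_i−2} ζ(s₁,…,s_{i−1}, s_i−j, j+1, s_{i+1},…,s_k) (Hoffman1992 Thm 5.1 = IKZ Thm 2 (v) with
m = 1 = derivation relation ∂₁, IKZ Cor 6), written as a ℤ-combination of the simplex
representations `KZ.mzvRep`, lies in KZ.relations. Output of the lever (first regularised family);
stated over any Z agreeing with the simplex classes on admissible indices. [deps: ReducedPeriodRing]
[difficulty: L] -/
@[route_item "route-KontsevichZagierPeriods-FurushoPentagon", crux]
def HoffmanRelationInKZ : Prop :=
  ∀ Z : List ℕ → Literature.NumberTheory.Transcendental.KZ.FormalRep, (∀ (u : List ℕ) (hu : Literature.NumberTheory.Transcendental.MZV.IsAdmissible u), Z u = Literature.NumberTheory.Transcendental.KZ.of (Literature.NumberTheory.Transcendental.KZ.mzvRep u hu (Literature.NumberTheory.Transcendental.KZ.mzvIntegrand_isSemialgebraicFunOn_holds u) (Literature.NumberTheory.Transcendental.KZ.mzvIntegrand_integrableOn_holds u hu))) → ∀ s : List ℕ, Literature.NumberTheory.Transcendental.MZV.IsAdmissible s → ((List.range s.length).map (fun i => Z (s.take i ++ [s.getD i 0 + 1] ++ s.drop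 (i + 1)))).sum - ((List.range s.length).map (fun i => ((List.range (s.getD i 0 - 1)).map (fun j => Z (s.take i ++ [s.getD i 0 - j, j + 1] ++ s.drop (i + 1)))).sum)).sum ∈ Literature.NumberTheory.Transcendental.KZ.relations

-- `HoffmanRelationInKZ` holds: proved by `Summit.KontsevichZagierPeriods.FurushoPentagon.HoffmanRelationInKZ.hoffmanRelationInKZ_proof` (its module imports this route file, so no `_holds` link can be stated here).

/-- item stmt-KontsevichZagierPeriods-3931 · crux · rank 5 · closed · proved by Summit.KontsevichZagierPeriods.FurushoPentagon.StuffleInKZ.StuffleInKZ_of (prover) · by planner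
why it might fail: The stuffle is native to SERIES; in the calculus it needs cubical partial fractions with convergent pieces (0275 plan) or the pentagon lever; an additive move-invariant of FormalRep separating ζ(2)² − 2ζ(2,2) − ζ(4) from 0 refutes it (and the summit). (PROVED 2026-08-16.)
sources: Hoffman1997, IharaKanekoZagier2006, Zagier1994, Furusho2011
[crux] for admissible s, t the harmonic (stuffle) product [mzvRep s]·[mzvRep t] − Σ_{u ∈ s∗t}
[mzvRep u] (Hoffman1997 §2; `MZV.stuffle`, with multiplicity) lies in KZ.relations — the finite half
of double shuffle that is NOT a dissection. Its weight-4 instance with ShuffleIsDissection is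
Grothendieck 0275. [deps: ReducedPeriodRing] [difficulty: L] -/
@[route_item "route-KontsevichZagierPeriods-FurushoPentagon", crux]
def StuffleInKZ : Prop :=
  ∀ Z : List ℕ → Literature.NumberTheory.Transcendental.KZ.FormalRep, (∀ (u : List ℕ) (hu : Literature.NumberTheory.Transcendental.MZV.IsAdmissible u), Z u = Literature.NumberTheory.Transcendental.KZ.of (Literature.NumberTheory.Transcendental.KZ.mzvRep u hu (Literature.NumberTheory.Transcendental.KZ.mzvIntegrand_isSemialgebraicFunOn_holds u) (Literature.NumberTheory.Transcendental.KZ.mzvIntegrand_integrableOn_holds u hu))) → ∀ s t : List ℕ, Literature.NumberTheory.Transcendental.MZV.IsAdmissible s → Literature.NumberTheory.Transcendental.MZV.IsAdmissible t → Z s * Z t - ((Literature.NumberTheory.Transcendental.MZV.stuffle s t).map Z).sum ∈ Literature.NumberTheory.Transcendental.KZ.relations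

-- `StuffleInKZ` holds: proved by `Summit.KontsevichZagierPeriods.FurushoPentagon.StuffleInKZ.StuffleInKZ_of` (its module imports this route file, so no `_holds` link can be stated here).

/-- item stmt-KontsevichZagierPeriods-15045 · crux · rank 8 · open · by planner
why it might fail: Open transcendence (= period conjecture for MT(ℤ) on MZVs ⟺ ZagierConjecture given Brown2012): false iff ONE ℚ-linear relation among real Hoffman values ζ(s), s ∈ {2,3}^×; weight 5 already needs ζ(5) ∉ ℚζ(2)ζ(3); known only for weight ≤ 4 and ζ(3) ∉ ℚ.
sources: Brown2012, arXiv:1102.1312, Hoffman1997, Zagier1994, Andre2004, HuberMullerStach2017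
[crux] DECLARED TRANSCENDENCE INPUT — NAMED, NOT ATTACKED FROM THIS ROUTE (route-repair 2026-08-16:
the hypothesis that scopes MzvKernelInKZ to motivic relations; D-0027 §2.2: a hypothesis of `closes`
is a crux). The real Hoffman values ζ(u), u ∈ {2,3}^× (all weights together, ζ(∅) = 1 included), are
ℚ-linearly independent. Given Brown's theorem (Literature fact hoffmanSpan_eq_mzvSpace, Brown2012
Thm 1.1) and zagierDim_eq_card_hoffman this is EQUIVALENT to
Literature.NumberTheory.Transcendental.ZagierConjecture (dimension conjecture ∧ weight grading;
Zagier1994 §9, GoncharovECM2001 Conj. 1.1), i.e. to injectivity of the period map H → ℝ on Brown's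
motivic MZVs (Grothendieck's period conjecture for MT(ℤ) restricted to MZVs). Verbatim the
hypothesis `HoffmanIndependent` of the two-posets line (Theorems/MzvKernelInKZTwoPosetsDefs.lean;
bridge `ZagierConjecture → hoffmanSpan_eq_mzvSpace → HoffmanIndependent`,
Theorems/MzvKernelInKZTwoPosetsHoffmanIndependence.lean) and of route CoactionDevissage item
SectorAssembly. It is the ONLY transcendence content of the route's MZV sector: HoffmanSpanInKZ ∧
HoffmanIndependence ⇒ MzvKernelInKZ (proved inside `closes`); conversely MzvKernelInKZ for -/
@[route_item "route-KontsevichZagierPeriods-FurushoPentagon", crux]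
def MzvPeriodConjecture : Prop :=
  LinearIndependent ℚ (fun u : {u : List ℕ // Literature.NumberTheory.Transcendental.MZV.IsHoffman u} => Literature.NumberTheory.Transcendental.multipleZeta u.1)

-- earlier SectorToKernel (stmt-KontsevichZagierPeriods-3936, replaced 2026-08-15T16:24:25Z -> stmt-KontsevichZagierPeriods-10813): retired by None — Summit.KontsevichZagierPeriods.KontsevichZagierPeriods.Theses.FurushoPentagon.StuffleInKZ → Summit.KontsevichZagierPeriods.KontsevichZagierPeriods.Theses.FurushoPentagon.HoffmanRelationInKZ → Literature.NumberTheory.Transcendental.KZKernelConjecture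
/-- item stmt-KontsevichZagierPeriods-10813 · crux (kind.auto-crux: conjecture-grade) · rank 9 · open · by planner
why it might fail: Both antecedents are theorems, so this IS the kernel form of Conjecture 1: false iff some ℤ-combination c with eval c = 0 has no move chain — e.g. a vanishing relation needing a non-semialgebraic Stokes primitive (Ayoub2015 Conj 1.1) or an MZV relation outside IKZ family (3).
sources: KontsevichZagier2001, Ayoub2015, Ayoub2014, IharaKanekoZagier2006, Brown2012, HuberMullerStach2017
[support] COMPLEMENT of the sector (open problem, not staffed by this route's mechanism): the typed
EDS core (StuffleInKZ ∧ HoffmanRelationInKZ) ⇒ the kernel form ∀ c, KZ.eval c = 0 → c ∈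
KZ.relations, written out (it is `KZKernelConjecture` unfolded — Iff.rfl with the rev-0 statement,
checked in the planner's Sketch.lean — so that no decl of the route names the conjecture leaf).
Inside the MZV span this is [Brown2012 + the period conjecture for MT(ℤ) (`ZagierConjecture`)] +
[IKZ Conjecture 1 in form (3): FDS + Hoffman generate all relations]; outside it, it is the rest of
Conjecture 1 (routes Grothendieck / NoriTransfer). Filed only to close the assembly's type honestly;
summit-strength, keep unstaffed. [difficulty: open-problem] -/
@[route_item "route-KontsevichZagierPeriods-FurushoPentagon"]
def SectorToKernel : Prop :=
  Summit.KontsevichZagierPeriods.KontsevichZagierPeriods.Theses.FurushoPentagon.StuffleInKZ → Summit.KontsevichZagierPeriods.KontsevichZagierPeriods.Theses.FurushoPentagon.HoffmanRelationInKZ → ∀ c : Literature.NumberTheory.Transcendental.KZ.FormalRep, Literature.NumberTheory.Transcendental.KZ.eval c = 0 → c ∈ Literature.NumberTheory.Transcendental.KZ.relations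

/-- item stmt-KontsevichZagierPeriods-15058 · crux · rank 9 · open · by planner
why it might fail: NOT CLAIMED: off the MZV sector it is Conjecture 1 (false as soon as one vanishing ℤ-combination with an elliptic/Γ/log member has no move chain); on the sector it is exactly GRT₁ ≅ U^{dR}_{MT(ℤ)} (false iff dim(𝔤𝔯𝔱₁)_k > dim(𝔤^𝔪)_k for some k; verified k ≤ 13).
sources: KontsevichZagier2001, Drinfeld1991, Furusho2011, arXiv:0808.0319, Brown2012, arXiv:1102.1312
[crux] DECLARED REMAINDER — NOT CLAIMED as a whole (rev 18, judge-repair: the 1:1 RESTATEMENT of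
SectorToKernelOfPentagon stmt-14829): MzvPeriodConjecture → PentagonInKZ → ReducedPeriodRing →
SectorToKernel — given the NAMED transcendence input (period conjecture for MT(ℤ) on MZVs, Hoffman
form) and the two mechanism cruxes, Conjecture 1's kernel form ∀ c, KZ.eval c = 0 → c ∈ KZ.relations
(SectorToKernel's own antecedents StuffleInKZ, HoffmanRelationInKZ being theorems). WEAKER than the
rev-15 complement it replaces (one more antecedent; `fun h _ => h` derives it from
SectorToKernelOfPentagon, `fun hK _ _ _ => hK` from SectorToKernel — so the crux chain running on
stmt-10813 closes it as a by-product), and no longer 'mechanism ⇒ summit with no named intermediate'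
(the judge's smuggling flag of the 2026-08-16 tier pass). CONTENT, exactly: ON the multiple-zeta
sector it is the algebraic leaf AssociatorHoffmanSpanning — for every admissible s ONE finitely
supported b : List ℕ →₀ ℚ on Hoffman indices of the same weight with c_{binaryWord s}(φ) = Σ_t b_t
c_{binaryWord t}(φ) at every group-like solution φ of Drinfeld's pentagon over every REDUCED
commutative ℚ-algebra (typed and lean-che -/
@[route_item "route-KontsevichZagierPeriods-FurushoPentagon", crux]
def KernelModuloPeriodConjecture : Prop :=
  Summit.KontsevichZagierPeriods.KontsevichZagierPeriods.Theses.FurushoPentagon.MzvPeriodConjecture → Summit.KontsevichZagierPeriods.KontsevichZagierPeriods.Theses.FurushoPentagon.PentagonInKZ → Summit.KontsevichZagierPeriods.KontsevichZagierPeriods.Theses.FurushoPentagon.ReducedPeriodRing → Summit.KontsevichZagierPeriods.KontsevichZagierPeriods.Theses.FurushoPentagon.SectorToKernel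

-- earlier KernelImpliesReduced (stmt-KontsevichZagierPeriods-3935, replaced 2026-08-15T16:49:54Z -> stmt-KontsevichZagierPeriods-11125): retired by None — Literature.NumberTheory.Transcendental.KZKernelConjecture → ∀ c : Literature.NumberTheory.Transcendental.KZ.FormalRep, c * c ∈ Literature.NumberTheory.Transcendental.KZ.relations → c ∈ Literature.NumberTheory.Transcendental.KZ.relations
/-- item stmt-KontsevichZagierPeriods-11125 · support · rank 9 · closed · proved by Summit.KontsevichZagierPeriods.FurushoPentagon.kernelImpliesReduced_proof (prover) · by planner
sources: KontsevichZagier2001, Ayoub2014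
[support] reducedness is necessary: the kernel form (∀ c, KZ.eval c = 0 → c ∈ KZ.relations, i.e.
`KZKernelConjecture` unfolded — written out at rev 3 so that no decl of the route names the
conjecture leaf; Iff.rfl with the rev-0 statement) ⇒ ReducedPeriodRing (eval(c·c) = (eval c)² by
`KZ.eval_mul'`, soundness `KZ.relations_le_ker_eval_holds`, mul_self_eq_zero; 5-line proof
re-checked in the planner's Sketch.lean, candidate proofs already attached to stmt-3935). Documents
that crux ReducedPeriodRing cannot be false unless Conjecture 1 is. [difficulty: provable-now] -/
@[route_item "route-KontsevichZagierPeriods-FurushoPentagon"]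
def KernelImpliesReduced : Prop :=
  (∀ c : Literature.NumberTheory.Transcendental.KZ.FormalRep, Literature.NumberTheory.Transcendental.KZ.eval c = 0 → c ∈ Literature.NumberTheory.Transcendental.KZ.relations) → ∀ c : Literature.NumberTheory.Transcendental.KZ.FormalRep, c * c ∈ Literature.NumberTheory.Transcendental.KZ.relations → c ∈ Literature.NumberTheory.Transcendental.KZ.relations

-- `KernelImpliesReduced` holds: proved by `Summit.KontsevichZagierPeriods.FurushoPentagon.kernelImpliesReduced_proof` (its module imports this route file, so no `_holds` link can be stated here).

/-- item stmt-KontsevichZagierPeriods-11351 · support · rank 9 · closed · proved by Summit.KontsevichZagierPeriods.FurushoPentagon.FurushoOverReduced.furushoOverReduced_proof (prover) · by planner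
sources: Furusho2011, arXiv:0808.0319, Racinet2002, IharaKanekoZagier2006
[support] FurushoOverReduced (rev 2, replaces FurushoTransfer stmt-5054; the LEVER of the route,
known result + routine commutative algebra, PROVABLE NOW). Furusho2011 Thm 1.2 over any REDUCED
commutative ℚ-algebra R: a group-like φ ∈ R⟨⟨X₀,X₁⟩⟩ (`NCSeries.IsGroupLike`) satisfying Drinfeld's
pentagon (`NCSeries.DrinfeldPentagon`) satisfies the generalised double shuffle relation Δ_*(φ_*) =
φ_* ⊗̂ φ_* (`NCSeries.GeneralisedDoubleShuffle`; Furusho2011 §2, Racinet2002 Def 3.1 up to signs).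
PROOF ROUTE: the field case (k a field of characteristic 0) is the tree's THEOREM
`furusho_pentagon_doubleShuffle_holds` (AssociatorsDoubleShuffleProofs.lean, 2026-08-15 =
Furusho2011 Thm 1.2; cf. planner's Equiv2.lean `furushoOverReduced_field`); for reduced R the
nilradical ⋂_𝔭 𝔭 is 0, so R ↪ ∏_𝔭 Frac(R ⧸ 𝔭), each factor a field of characteristic 0 (R is a
ℚ-algebra); push φ forward with `IsGroupLike.map` / `DrinfeldPentagon.map`, apply the theorem in
every factor, and descend with `GeneralisedDoubleShuffle.of_map` (injective change of coefficients —
the relation is a family of polynomial identities in the coefficients; its docstring records exactly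
this use). ROLE IN THE MECHANISM: at R = P_ℚ = ℚ -/
@[route_item "route-KontsevichZagierPeriods-FurushoPentagon"]
def FurushoOverReduced : Prop :=
  ∀ (R : Type) [CommRing R] [Algebra ℚ R] [IsReduced R] (φ : Literature.NumberTheory.Transcendental.NCSeries Bool R), Literature.NumberTheory.Transcendental.NCSeries.IsGroupLike φ → Literature.NumberTheory.Transcendental.NCSeries.DrinfeldPentagon φ → Literature.NumberTheory.Transcendental.NCSeries.GeneralisedDoubleShuffle φ

-- `FurushoOverReduced` holds: proved by `Summit.KontsevichZagierPeriods.FurushoPentagon.FurushoOverReduced.furushoOverReduced_proof` (its module imports this route file, so no `_holds` link can be stated here).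

/-- item stmt-KontsevichZagierPeriods-14665 · support · rank 9 · closed · proved by Summit.KontsevichZagierPeriods.FurushoPentagon.DoubleShuffleInKZ.doubleShuffleInKZ_proof @ a9c0c59d10da (prover) · by planner
sources: IharaKanekoZagier2006, Racinet2002, Furusho2011, arXiv:0808.0319
[support] DoubleShuffleInKZ — the mechanism's OUTPUT, i.e. the thesis' deliverable ('every
regularised double-shuffle relation inside the KZ calculus'); filed at rev 10 once
StuffleInKZ/HoffmanRelationInKZ closed and MZV.shuffleReg landed (the NOT-DECOMPOSED-YET item
'RegularisedDoubleShuffleInKZ'). REALISATION FORM, same binder telescope as PentagonInKZ: for every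
commutative ℚ-algebra R, every realisation χ : KZ.FormalRep →+ R of the rules (additive, killing
KZ.relations, multiplicative for the Fubini product, non-degenerate) and every Z pinned to the
simplex classes on admissible indices, the χ-valued shuffle-regularised MZV series Φ_{χ,Z} := Σ_W
(−1)^{#X₁(W)} (Σ_v reg_ш(W)(v)·χ(Z(index of v)))·W satisfies Furusho's generalised double shuffle
Δ_*(Φ_*) = Φ_* ⊗̂ Φ_* (`NCSeries.GeneralisedDoubleShuffle`; Furusho2011 §2 = Racinet2002 Def 3.1 up
to signs): coefficientwise the FULL regularised stuffle family c_u(Φ_*)c_v(Φ_*) = Σ_{w ∈ u∗v}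
c_w(Φ_*) for ALL index pairs with entries ≥ 1 (correction term included) — IharaKanekoZagier2006 Thm
2's EDS family; the proved StuffleInKZ (admissible pairs: c_s(Φ_*) = χ(Z s) by
`seriesShuffleReg_apply_of_isAdmissible`, sign (−1)^{|s|}·(−1)^{|s|}) -/
@[route_item "route-KontsevichZagierPeriods-FurushoPentagon"]
def DoubleShuffleInKZ : Prop :=
  ∀ (R : Type) [CommRing R] [Algebra ℚ R] (χ : Literature.NumberTheory.Transcendental.KZ.FormalRep →+ R), (∀ c ∈ Literature.NumberTheory.Transcendental.KZ.relations, χ c = 0) → (∀ a b : Literature.NumberTheory.Transcendental.KZ.FormalRep, χ (a * b) = χ a * χ b) → (∃ u : Literature.NumberTheory.Transcendental.KZ.FormalRep, χ u = 1) → ∀ Z : List ℕ → Literature.NumberTheory.Transcendental.KZ.FormalRep, (∀ (u : List ℕ) (hu : Literature.NumberTheory.Transcendental.MZV.IsAdmissible u), Z u = Literature.NumberTheory.Transcendental.KZ.of (Literature.NumberTheory.Transcendental.KZ.mzvRep u hu (Literature.NumberTheory.Transcendental.KZ.mzvIntegrand_isSemialgebraicFunOn_holds u) (Literature.NumberTheory.Transcendental.KZ.mzvIntegrand_integrableOn_holds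 u hu))) → Literature.NumberTheory.Transcendental.NCSeries.GeneralisedDoubleShuffle (R := R) (fun W : List Bool => (-1 : R) ^ (W.count true) * (Literature.NumberTheory.Transcendental.MZV.shuffleReg W).sum (fun v a => a • (if Literature.NumberTheory.Transcendental.MZV.IsConvergentWord v then χ (Z (Literature.NumberTheory.Transcendental.MZV.ofBinaryWord v)) else (0 : R))))

-- `DoubleShuffleInKZ` holds: proved by `Summit.KontsevichZagierPeriods.FurushoPentagon.DoubleShuffleInKZ.doubleShuffleInKZ_proof` @ a9c0c59d10da (its module imports this route file, so no `_holds` link can be stated here).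

-- earlier DoubleShuffleOfPentagon (stmt-KontsevichZagierPeriods-14666, replaced 2026-08-16T05:40:43Z -> stmt-KontsevichZagierPeriods-14669): retired by None — Summit.KontsevichZagierPeriods.KontsevichZagierPeriods.Theses.FurushoPentagon.PentagonInKZ → Summit.KontsevichZagierPeriods.KontsevichZagierPeriods.Theses.FurushoPentagon.ShuffleIsDissection → Summit.KontsevichZagierPeriods.KontsevichZagierPer
/-- item stmt-KontsevichZagierPeriods-14669 · support · rank 9 · closed · proved by Summit.KontsevichZagierPeriods.FurushoPentagon.DoubleShuffleOfPentagon.doubleShuffleOfPentagon_proof (prover) · by planner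
sources: Furusho2011, IharaKanekoZagier2006, Racinet2002, KontsevichZagier2001
[support] DoubleShuffleOfPentagon — the route's MECHANISM as ONE kernel-checkable implication from
exactly the two OPEN cruxes to the deliverable, PROVABLE NOW (pure algebra + one combinatorial
lemma; size M–L): PentagonInKZ → ReducedPeriodRing → DoubleShuffleInKZ (rev 11 restatement of the
rev-10 form, which also listed ShuffleIsDissection and IntegerDivision as antecedents: both are
PROVED — `shuffleIsDissection_proof`, `integerDivision_proof` — and are invoked as theorems, like
`furushoOverReduced_proof`; the rev-10 decl could not be rendered because the gate orders support
items by id string and the two named decls come later in the file). Sketch: P := KZ.FormalRep ⧸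
KZ.relations (`KZ.FormalPeriodRing`), P_ℚ := ℚ ⊗ P, χ₀ the universal realisation. (i)
ReducedPeriodRing (c·c ∈ rel ⇒ c ∈ rel, hence no nilpotents since KZ.relations is an ideal) +
IntegerDivision (theorem; P torsion-free) ⇒ P ↪ P_ℚ and P_ℚ, a localisation of a reduced ring, is a
REDUCED commutative ℚ-algebra (and ∃ u, χ₀ u = 1 with u = [pt,1]). (ii) PentagonInKZ at (P_ℚ, χ₀,
simplex classes) ⇒ `DrinfeldPentagon Φ₀`. (iii) ShuffleIsDissection (theorem) ⇒ `IsGroupLike Φ₀`: on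
convergent words it is the dissection pus -/
@[route_item "route-KontsevichZagierPeriods-FurushoPentagon"]
def DoubleShuffleOfPentagon : Prop :=
  Summit.KontsevichZagierPeriods.KontsevichZagierPeriods.Theses.FurushoPentagon.PentagonInKZ → Summit.KontsevichZagierPeriods.KontsevichZagierPeriods.Theses.FurushoPentagon.ReducedPeriodRing → Summit.KontsevichZagierPeriods.KontsevichZagierPeriods.Theses.FurushoPentagon.DoubleShuffleInKZ

-- `DoubleShuffleOfPentagon` holds: proved by `Summit.KontsevichZagierPeriods.FurushoPentagon.DoubleShuffleOfPentagon.doubleShuffleOfPentagon_proof` (its module imports this route file, so no `_holds` link can be stated here).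

/-- item stmt-KontsevichZagierPeriods-3932 · support · rank 9 · closed · proved by Summit.KontsevichZagierPeriods.FurushoPentagon.ShuffleIsDissection.shuffleIsDissection_proof (prover) · by planner
sources: Eie2013, KontsevichZagier2001, Brown2012
[support] for admissible s, t: [mzvRep s]·[mzvRep t] − Σ_{w ∈ ε(s) ш ε(t)} [mzvRep w] ∈ KZ.relations
(Eie2013 §1.2): the product domain Δ_s × Δ_t minus the null tie-walls is the disjoint union of the
shuffle cells, each a coordinate permutation (`KZ.of_sub_of_reindex_mem_relations`) of a standard
simplex with the interleaved integrand — moves (1a) + (2) only. This is group-likeness of Φ_P (X2).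
[difficulty: M] -/
@[route_item "route-KontsevichZagierPeriods-FurushoPentagon"]
def ShuffleIsDissection : Prop :=
  ∀ Z : List ℕ → Literature.NumberTheory.Transcendental.KZ.FormalRep, (∀ (u : List ℕ) (hu : Literature.NumberTheory.Transcendental.MZV.IsAdmissible u), Z u = Literature.NumberTheory.Transcendental.KZ.of (Literature.NumberTheory.Transcendental.KZ.mzvRep u hu (Literature.NumberTheory.Transcendental.KZ.mzvIntegrand_isSemialgebraicFunOn_holds u) (Literature.NumberTheory.Transcendental.KZ.mzvIntegrand_integrableOn_holds u hu))) → ∀ s t : List ℕ, Literature.NumberTheory.Transcendental.MZV.IsAdmissible s → Literature.NumberTheory.Transcendental.MZV.IsAdmissible t → Z s * Z t - ((Literature.NumberTheory.Transcendental.MZV.shuffleWord (Literature.NumberTheory.Transcendental.MZV.binaryWord s) (Literature.NumberTheory.Transcendental.MZV.binaryWord t)).map (fun w => Z (Literature.NumberTheory.Transcendental.MZV.ofBinaryWord w))).sum ∈ Literature.NumberTheory.Transcendental.KZ.relations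

-- `ShuffleIsDissection` holds: proved by `Summit.KontsevichZagierPeriods.FurushoPentagon.ShuffleIsDissection.shuffleIsDissection_proof` (its module imports this route file, so no `_holds` link can be stated here).

/-- item stmt-KontsevichZagierPeriods-3933 · support · rank 9 · closed · proved by Summit.KontsevichZagierPeriods.FurushoPentagon.DualityInKZ.DualityInKZ_proof @ b03e6b617908 (prover) · by planner
sources: Zagier1994, Hoffman1992, Furusho2010
[support] duality ζ(s) = ζ(s†) (`MZV.dual`; Zagier1994 §9, Hoffman1992 Thm 4.4) is ONE change of
variables t_i ↦ 1 − t_{w−1−i} of the ordered simplex (|det| = 1, swaps dt/t ↔ dt/(1−t) and reverses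
the order): `KZ.Equivalent (mzvRep s) (mzvRep s†)`. Calibration of the simplex conventions and the
coefficientwise shadow of the 2-cycle relation Φ(X₀,X₁)Φ(X₁,X₀) = 1 (Furusho2010: implied by the
pentagon); gives ζ(2,1) = ζ(3) and ζ(2,1,1) = ζ(4) for free. [difficulty: provable-now] -/
@[route_item "route-KontsevichZagierPeriods-FurushoPentagon"]
def DualityInKZ : Prop :=
  ∀ (s : List ℕ) (hs : Literature.NumberTheory.Transcendental.MZV.IsAdmissible s), Literature.NumberTheory.Transcendental.KZ.Equivalent (Literature.NumberTheory.Transcendental.KZ.mzvRep s hs (Literature.NumberTheory.Transcendental.KZ.mzvIntegrand_isSemialgebraicFunOn_holds s) (Literature.NumberTheory.Transcendental.KZ.mzvIntegrand_integrableOn_holds s hs)) (Literature.NumberTheory.Transcendental.KZ.mzvRep (Literature.NumberTheory.Transcendental.MZV.dual s) (Literature.NumberTheory.Transcendental.MZV.isAdmissible_dual hs) (Literature.NumberTheory.Transcendental.KZ.mzvIntegrand_isSemialgebraicFunOn_holds (Literature.NumberTheory.Transcendental.MZV.dual s)) (Literature.NumberTheory.Transcendental.KZ.mzvIntegrand_integrableOn_holds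 (Literature.NumberTheory.Transcendental.MZV.dual s) (Literature.NumberTheory.Transcendental.MZV.isAdmissible_dual hs)))

-- `DualityInKZ` holds: proved by `Summit.KontsevichZagierPeriods.FurushoPentagon.DualityInKZ.DualityInKZ_proof` @ b03e6b617908 (its module imports this route file, so no `_holds` link can be stated here).

/-- item stmt-KontsevichZagierPeriods-3934 · support · rank 9 · closed · proved by Summit.KontsevichZagierPeriods.FurushoPentagon.integerDivision_proof (prover) · by planner
sources: KontsevichZagier2001
[support] division by a positive integer is a DERIVED rule although "no division by integers is a
rule" (Statement.lean): n•c ∈ KZ.relations ⇒ c ∈ KZ.relations. Proof sketch: S_n[σ,f] := [σ, f/n]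
maps each of the four move families to itself, so S_n(relations) ⊆ relations; and c − n•S_n c ∈
relations by iterated integrand additivity; hence c = (c − n S_n c) + S_n(n c) ∈ relations. Needed
to pull Furusho's conclusions back from P_ℚ to P. [difficulty: M] -/
@[route_item "route-KontsevichZagierPeriods-FurushoPentagon"]
def IntegerDivision : Prop :=
  ∀ (c : Literature.NumberTheory.Transcendental.KZ.FormalRep) (n : ℕ), 0 < n → n • c ∈ Literature.NumberTheory.Transcendental.KZ.relations → c ∈ Literature.NumberTheory.Transcendental.KZ.relations

-- `IntegerDivision` holds: proved by `Summit.KontsevichZagierPeriods.FurushoPentagon.integerDivision_proof` (its module imports this route file, so no `_holds` link can be stated here).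

-- earlier Assembly (stmt-KontsevichZagierPeriods-3937, replaced 2026-08-15T16:21:53Z -> stmt-KontsevichZagierPeriods-10718): retired by None — Summit.KontsevichZagierPeriods.KontsevichZagierPeriods.Theses.FurushoPentagon.StuffleInKZ → Summit.KontsevichZagierPeriods.KontsevichZagierPeriods.Theses.FurushoPentagon.HoffmanRelationInKZ → Summit.KontsevichZagierPeriods.KontsevichZagierPeriods.Theses.Furus
/-- item stmt-KontsevichZagierPeriods-10718 · assembly · rank 1 · closed · proved by Summit.KontsevichZagierPeriods.FurushoPentagon.assembly_proof (prover) · by planner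
sources: KontsevichZagier2001, Furusho2011
[assembly] StuffleInKZ → HoffmanRelationInKZ → SectorToKernel → KontsevichZagierPeriods (rev 1: the
kernel-form ⇒ Statement step, formerly the shared item KernelImpliesStatement stmt-0197, is inlined
in the deciding theorem `closes`; SectorToKernel concludes the kernel form written out). -/
@[route_item "route-KontsevichZagierPeriods-FurushoPentagon"]
def Assembly : Prop :=
  Summit.KontsevichZagierPeriods.KontsevichZagierPeriods.Theses.FurushoPentagon.StuffleInKZ → Summit.KontsevichZagierPeriods.KontsevichZagierPeriods.Theses.FurushoPentagon.HoffmanRelationInKZ → Summit.KontsevichZagierPeriods.KontsevichZagierPeriods.Theses.FurushoPentagon.SectorToKernel → KontsevichZagierPeriods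

-- `Assembly` holds: proved by `Summit.KontsevichZagierPeriods.FurushoPentagon.assembly_proof` (its module imports this route file, so no `_holds` link can be stated here).

-- records of items no longer active in this route (dropped / restated):
-- earlier SectorToKernelOfPentagon (stmt-KontsevichZagierPeriods-14829, replaced 2026-08-16T07:38:51Z -> stmt-KontsevichZagierPeriods-15058): retired by None — Summit.KontsevichZagierPeriods.KontsevichZagierPeriods.Theses.FurushoPentagon.PentagonInKZ → Summit.KontsevichZagierPeriods.KontsevichZagierPeriods.Theses.FurushoPentagon.ReducedPeriodRing → Summit.KontsevichZagierPeriods.KontsevichZagierPeri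
-- earlier FurushoTransfer (stmt-KontsevichZagierPeriods-5054, replaced 2026-08-15T17:22:50Z -> stmt-KontsevichZagierPeriods-11351): retired by None — Literature.NumberTheory.Transcendental.NCSeries.IsGroupLike Literature.NumberTheory.Transcendental.KZ.rulesAssociator → Literature.NumberTheory.Transcendental.NCSeries.DrinfeldPentagon Literature.NumberTheory.Transcendental.KZ.rulesAssociator → Summit.

/-! D-0027 §2.1 — DECIDING THEOREM (planner-authored via `route open/edit --closes-file`; by planner-rrepair-KontsevichZagierPeriods-Furush-294e16d9-0 2026-08-16T07:38:51Z):
its hypotheses are this route's items and its conclusion the sub-problem Statement (glue_lint), and it elaborates with this file. -/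

@[closes "route-KontsevichZagierPeriods-FurushoPentagon"] theorem closes (hP : PentagonInKZ) (hR : ReducedPeriodRing) (hZ : MzvPeriodConjecture)
    (hC : KernelModuloPeriodConjecture) (hS : StuffleInKZ) (hH : HoffmanRelationInKZ) :
    KontsevichZagierPeriods := by
  intro n m r r' _ _ hv
  have h0 : Literature.NumberTheory.Transcendental.KZ.eval
      (Literature.NumberTheory.Transcendental.KZ.of r - Literature.NumberTheory.Transcendental.KZ.of r') = 0 := by
    simp [Literature.NumberTheory.Transcendental.KZ.eval_of, hv]
  exact hC hZ hP hR hS hH _ h0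

end Summit.KontsevichZagierPeriods.KontsevichZagierPeriods.Theses.FurushoPentagon
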